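import Summits.Ventures.CertifiedManyBodySolver.Theorems.TcThermcert1FarCutPerBond
import Summits.Ventures.CertifiedManyBodySolver.Theorems.TcThermcert1FarCutAsymptotics
import Mathlib
import HarnessLib

/-!
# Stub B of line `gauge_qbp_far_seam`: the far-cut persistent current vanishes under flux-free current clustering (part D, main)

Helper module (theorems only) for route `TcThermcert1`, cruxes K1′ `ThermalStiffnessCeilingU8b8_le_7o44`
(item `stmt-Ventures-24560`) and K1 `ThermalStiffnessCeilingU8b10_le_1o8` (item `stmt-Ventures-26381`), line
`Cruxes/…/Lines/gauge_qbp_far_seam.lean` v1.3, registered stub B `stub_farCutCurrent_of_clustering`: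
`0 < β → CurrentClustering U n β ξ → ∃ θ₁ > 0, PersistentCurrentVanishes U n β θ₁`. The main theorem
`farCutCurrent_vanishes_of_currentClustering` is that implication with the line's definitions UNFOLDED (the line file
cannot be imported here): it is stated for an arbitrary family `p L` of coordinate predicates that are unions of
`(N↑, N↓)` sectors (hypothesis `hp`; in the line, `p L = sectorPred L (1 - n)` and `hp` is
`sectorPreserving_of_preservesSectors`), so that the stub body in the line file becomes
`unfold CurrentClustering SectorPreserving sectorExpect bondCurrent at h;
 unfold PersistentCurrentVanishes farCutCurrent sectorExpect bondCurrent antipode;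
 exact farCutCurrent_vanishes_of_currentClustering (fun L => sectorPred L (1 - n))
   (fun L _ X hX => sectorPreserving_of_preservesSectors hX _) hβ h` (checked against the tree's line file).

This is the one-page ASSEMBLY of the landed quantum-belief-propagation chain (parts 1–6 and 7a–7e,
`Theorems/TcThermcert1Qbp*.lean`) and the Literature weight `f_β` (`Literature/…/QBPWeight.lean`), following
Capel–Moscolari–Teufel–Wessel, CMP 406 (2025) 43 = arXiv:2310.09182, Prop. 6 and Thm. 14 (local perturbations perturb
locally), in the fermionic canonical-sector form of the line:
* §1 torus geometry: the collar `X_r = {|x₁|_∘ ≤ r}` contains the seam columns, misses the antipodal cut for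
  `r + 2 ≤ ⌊L/2⌋`, and lies at torus distance `≥ ⌊L/2⌋ - 1 - r` from both ends of every far bond; `|Λ_L| = L²` and the
  seam-augmented index set has `≤ 4L⁴` elements.
* §2 instance transport: the torus files carry a shortcut `DecidableEq (Finset (Orb _))` instance while the generic
  CAR/sector lemmas carry `Finset.decidableEq`; subalgebra clauses and operator-norm bounds are transported along
  `Subsingleton.elim` (no `exact` between the two forms is ever attempted).
* §3 the per-bond estimate: with `E` the QBP conjugation `e^{-β(H₀+V_φ)} = E e^{-βH₀} Eᴴ` (`V_φ = seamTwist L φ`,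
  `‖V_φ‖ ≤ 4L|φ|`) and `Ẽ` the conjugation of the collar-restricted dynamics (part 6, weight `f_β`, ‖f_β‖₁ = 1, tail
  `e^{-πT/β}`, leakage `ε` from part 7e), `Ẽ` is even and supported in the collar (7a), hence commutes with the far
  current and `ẼᴴẼ` is an admissible test observable of Hypothesis C; part 5 gives
  `|ω_φ(j) - ω_0(j)| ≤ e^{β‖V‖}(C⁺ e^{β‖V‖} (L²)^k e^{-(⌊L/2⌋-1-r)/ξ} + 16 e^{β‖V‖/2} δ)` per bond, and on the window
  `|φ| ≤ θ ≤ 1/2` (with `r = ⌊L/4⌋`, `T = (⌊L/4⌋-2)/(88 e J₂)`, `J₂ = 3 + |U|`) an explicit `φ`-independent bound `B̄(L, θ)`.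
* §4 asymptotics: `L · B̄(L, θ) ≤ K_A L^{2k+1} e^{-L/(8ξ)} + K_B L^{12} e^{-L/16} + K_C L² e^{-πL/(704 e J₂ β)}` for `L ≥ 8`
  once `12βθ` is at most half of each rate, and `K L^m e^{-κL} → 0`.
* §5 the stub: time reversal (`Re ω_0(j) = 0`, `SeamTwistInputs`), the sum over the `L` bonds of the antipodal cut, and
  the window `θ₁ = min(1/2, 1/(96βξ), 1/(192β), π/(8448 e J₂ β²)) > 0`.
Design: localisation by RESTRICTED DYNAMICS (not by a conditional expectation as in print), QBP on the full Fock space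
compressed to the sector afterwards (part 5), the factor `e^{2β‖V‖}`-type costs are flux-proportional (`‖V_φ‖ ≤ 4L|φ|`) and
beaten by the three decay rates on the window — the twist is consumed at ONE positive flux as small as we please.
HONEST FRAMING. This closes stub B only; stub C8 (`CurrentClustering 8 (7/8) 8 ξ`) remains THE BET of the line.
K1′/K1 are finite-β stiffness CEILINGS conditional on that bet; nothing here is a lower bound on `T_c`, a number of
record, or a statement about order. SC in the Hubbard model is NOT proved by anything in this file.
-/

noncomputable section

open Filter Topology Set Real Matrix Finset MeasureTheory
open scoped Matrix.Norms.L2Operator ComplexOrder ComplexConjugate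
open Literature.MathematicalPhysics.QuantumLattice
open Literature.Probability.LatticeModels

namespace Summit.Ventures.CertifiedManyBodySolver.Theorems.TcThermcert1.GaugeQbpFarSeam

/-! ## §3′ The per-bond estimate, uniform on a flux window -/

section PerBond

variable (L : ℕ) [NeZero L]

/-- **Per-bond LPPL estimate, uniform on a flux window.** For `L ≥ 8`, collar radius `r = ⌊L/4⌋`, time cut-off
`T_L = (⌊L/4⌋ - 2)/(88 e J₂)` with `J₂ = 2 + |U| + 2·(1/2)` (so that the Lieb–Robinson exponent `44 e J(φ) T_L
    ≤ (⌊L/4⌋-2)/2`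
for `|φ| ≤ 1/2`), the leakage bound of part 7e and `‖seamTwist L φ‖ ≤ 4L|φ|
    ≤ 4Lθ`, the flux moves the far bond current by at
most an explicit `φ`-independent quantity `B̄(L, θ)` on the window `|φ| ≤ θ ≤ 1/2`.
[cite: CapelEtAl2023, Theorem 14 (with Remark 12); arXiv:2310.09182] -/
theorem norm_sectorGibbs_farBond_flux_sub_le_uniform (hL : 8 ≤ L)
    (p : Finset (Orb (FermionTorus 2 L)) → Prop) [DecidablePred p]
    (hp : ∀ X : Matrix (Finset (Orb (FermionTorus 2 L))) (Finset (Orb (FermionTorus 2 L))) ℂ,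
      PreservesSectors X → ∀ s t, p s → ¬ p t → X s t = 0 ∧ X t s = 0)
    (U : ℝ) {β : ℝ} (hβ : 0 < β) {ξ C : ℝ} {k : ℕ}
    (hC : ∀ (X : Finset (FermionTorus 2 L))
        (A : Matrix (Finset (Orb (FermionTorus 2 L))) (Finset (Orb (FermionTorus 2 L))) ℂ),
        A ∈ carEvenSubalgebra (orbSet X) → (∀ s t, p s → ¬ p t → A s t = 0 ∧ A t s = 0) →
        ∀ (X₀ y : ZMod L) (d : ℕ),
          (∀ x ∈ X, d ≤ torusDist x.toTorusSite ![X₀, y] ∧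
            d ≤ torusDist x.toTorusSite ![X₀ - 1, y]) →
          ‖gibbsState β ((hubbardTorusTT'Flux L 0 U 0).toBlock p p)
                ((A * ∑ σ : Fin 2,
                    ((-Complex.I) • (creation (orb (FermionTorus.ofTorusSite ![X₀, y]) σ) *
                        annihilation (orb (FermionTorus.ofTorusSite ![X₀ - 1, y]) σ)) +
                      Complex.I • (creation (orb (FermionTorus.ofTorusSite ![X₀ - 1, y]) σ) *
                        annihilation (orb (FermionTorus.ofTorusSite ![X₀, y]) σ)))).toBlock p p)
              - gibbsState β ((hubbardTorusTT'Flux L 0 U 0).toBlock p p) (A.toBlock p p) *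
                gibbsState β ((hubbardTorusTT'Flux L 0 U 0).toBlock p p)
                  ((∑ σ : Fin 2,
                    ((-Complex.I) • (creation (orb (FermionTorus.ofTorusSite ![X₀, y]) σ) *
                        annihilation (orb (FermionTorus.ofTorusSite ![X₀ - 1, y]) σ)) +
                      Complex.I • (creation (orb (FermionTorus.ofTorusSite ![X₀ - 1, y]) σ) *
                        annihilation (orb (FermionTorus.ofTorusSite ![X₀, y]) σ)))).toBlock p p)‖
            ≤ C * ‖A‖ * (X.card : ℝ) ^ k * Real.exp (-(d : ℝ) / ξ))
    {θ : ℝ} (hθ0 : 0 ≤ θ) (hθ : θ ≤ 1 / 2) {φ : ℝ} (hφ : |φ| ≤ θ) (y : ZMod L) :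
    ‖gibbsState β ((hubbardTorusTT'Flux L 0 U φ).toBlock p p)
          ((∑ σ : Fin 2,
              ((-Complex.I) • (creation (orb (FermionTorus.ofTorusSite ![((L / 2 : ℕ) : ZMod L), y]) σ) *
                  annihilation (orb (FermionTorus.ofTorusSite ![((L / 2 : ℕ) : ZMod L) - 1, y]) σ)) +
                Complex.I • (creation (orb (FermionTorus.ofTorusSite ![((L / 2 : ℕ) : ZMod L) - 1, y]) σ) *
                  annihilation (orb (FermionTorus.ofTorusSite ![((L / 2 : ℕ) : ZMod L), y]) σ)))).toBlock p p) -
        gibbsState β ((hubbardTorusTT'Flux L 0 U 0).toBlock p p)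
          ((∑ σ : Fin 2,
              ((-Complex.I) • (creation (orb (FermionTorus.ofTorusSite ![((L / 2 : ℕ) : ZMod L), y]) σ) *
                  annihilation (orb (FermionTorus.ofTorusSite ![((L / 2 : ℕ) : ZMod L) - 1, y]) σ)) +
                Complex.I • (creation (orb (FermionTorus.ofTorusSite ![((L / 2 : ℕ) : ZMod L) - 1, y]) σ) *
                  annihilation (orb (FermionTorus.ofTorusSite ![((L / 2 : ℕ) : ZMod L), y]) σ)))).toBlock p p)‖ ≤
      Real.exp (β * (4 * L * θ)) *
        (max C 0 * Real.exp (β * (4 * L * θ)) * ((L : ℝ) ^ 2) ^ k *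
            Real.exp (-((L / 2 - 1 - L / 4 : ℕ) : ℝ) / ξ) +
          4 * Real.exp (β / 2 * (4 * L * θ)) *
            (β / 2 *
                ((4 * (L : ℝ) ^ 4) *
                    (2 * (4 * L * θ) *
                      ((4 * (L : ℝ) ^ 4) *
                        (2 * (2 + |U| + 2 * (1 / 2 : ℝ)) * (2 + |U| + 2 * (1 / 2 : ℝ)) *
                            (((L / 4 - 2 : ℕ) : ℝ) / (88 * Real.exp 1 * (2 + |U| + 2 * (1 / 2 : ℝ)))) *
                          Real.exp (-((L / 4 - 2 : ℕ) : ℝ) / 2)))) *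
                    (((L / 4 - 2 : ℕ) : ℝ) / (88 * Real.exp 1 * (2 + |U| + 2 * (1 / 2 : ℝ)))) +
                  2 * (4 * L * θ) *
                    Real.exp (-(π / β * (((L / 4 - 2 : ℕ) : ℝ) / (88 * Real.exp 1 * (2 + |U| + 2 * (1 / 2 : ℝ))))))) *
              Real.exp (β * (4 * L * θ))) *
            4) := by
  have hr : 2 ≤ L / 4 := by omega
  have hrL : L / 4 + 2 ≤ L / 2 := by omega
  have hφ2 : |φ| ≤ 1 / 2 := hφ.trans hθ
  have hJle : 2 + |U| + 2 * |φ| ≤ 2 + |U| + 2 * (1 / 2 : ℝ) := by linarith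
  have hJ0 : 0 < 2 + |U| + 2 * (1 / 2 : ℝ) := by positivity
  have hT0 : 0 ≤ ((L / 4 - 2 : ℕ) : ℝ) / (88 * Real.exp 1 * (2 + |U| + 2 * (1 / 2 : ℝ))) := by positivity
  have hVle : ‖seamTwist L φ‖ ≤ 4 * L * θ :=
    (norm_seamTwist_le L φ).trans (mul_le_mul_of_nonneg_left hφ (by positivity))
  -- the exponent of the Lieb–Robinson leakage at the cut-off
  have hexp : ∀ t : ℝ, |t| ≤ ((L / 4 - 2 : ℕ) : ℝ) / (88 * Real.exp 1 * (2 + |U| + 2 * (1 / 2 : ℝ))) →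
      Real.exp 1 * (2 * (2 + |U| + 2 * |φ|) * ((22 : ℕ) : ℝ)) * |t| - ((L / 4 - 2 : ℕ) : ℝ) ≤
        -((L / 4 - 2 : ℕ) : ℝ) / 2 := by
    intro t ht
    have h1 : Real.exp 1 * (2 * (2 + |U| + 2 * |φ|) * ((22 : ℕ) : ℝ)) * |t| ≤
        Real.exp 1 * (2 * (2 + |U| + 2 * (1 / 2 : ℝ)) * ((22 : ℕ) : ℝ)) *
          (((L / 4 - 2 : ℕ) : ℝ) / (88 * Real.exp 1 * (2 + |U| + 2 * (1 / 2 : ℝ)))) := by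
      gcongr
    have h2 : Real.exp 1 * (2 * (2 + |U| + 2 * (1 / 2 : ℝ)) * ((22 : ℕ) : ℝ)) *
          (((L / 4 - 2 : ℕ) : ℝ) / (88 * Real.exp 1 * (2 + |U| + 2 * (1 / 2 : ℝ)))) = ((L / 4 - 2 : ℕ) : ℝ) / 2 := by
      have he : Real.exp 1 ≠ 0 := (Real.exp_pos 1).ne'
      field_simp
      push_cast
      ring
    linarith
  -- hypothesis hε of the per-bond estimate, from part 7e and monotonicity in `|t|`
  have hε : ∀ s ∈ Icc (0:ℝ) 1, ∀ t : ℝ, |t| ≤ ((L / 4 - 2 : ℕ) : ℝ) / (88 * Real.exp 1 * (2 + |U| + 2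
      * (1 / 2 : ℝ))) →
      ‖heisenbergEvolution (hubbardTorusTT'Flux L 0 U 0 + (s : ℂ) • seamTwist L φ) t (seamTwist L φ) -
        heisenbergEvolution
          (∑ Z ∈ Finset.univ.filter (fun Z : HubbardIdx (fermionTorusGraph 2 L) =>
              hubbardTermSupp (fermionTorusGraph 2 L) Z ⊆
                Finset.univ.filter (fun x : FermionTorus 2 L =>
                  (FermionTorus.toTorusSite x 0).valMinAbs.natAbs ≤ L / 4)),
            hubbardTermOp (fermionTorusGraph 2 L) 1 U 0 Z + (s : ℂ) • seamTwist L φ) t (seamTwist L φ)‖ ≤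
      (Fintype.card (HubbardIdx (fermionTorusGraph 2 L) ⊕ (ZMod L × Fin 2)) : ℝ) *
        (2 * ‖seamTwist L φ‖ *
          ((Fintype.card (HubbardIdx (fermionTorusGraph 2 L) ⊕ (ZMod L × Fin 2)) : ℝ) *
            (2 * (2 + |U| + 2 * (1 / 2 : ℝ)) * (2 + |U| + 2 * (1 / 2 : ℝ)) *
                (((L / 4 - 2 : ℕ) : ℝ) / (88 * Real.exp 1 * (2 + |U| + 2 * (1 / 2 : ℝ)))) *
              Real.exp (-((L / 4 - 2 : ℕ) : ℝ) / 2)))) *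
        (((L / 4 - 2 : ℕ) : ℝ) / (88 * Real.exp 1 * (2 + |U| + 2 * (1 / 2 : ℝ)))) := by
    intro s hs t ht
    refine (norm_seamDynamics_sub_collar_le_of_radius L U φ hs hr t).trans ?_
    have h3 := hexp t ht
    have hn : 0 ≤ ‖seamTwist L φ‖ := norm_nonneg _
    have ht0 : 0 ≤ |t| := abs_nonneg t
    have hN : (0 : ℝ) ≤ (Fintype.card (HubbardIdx (fermionTorusGraph 2 L) ⊕ (ZMod L × Fin 2)) : ℝ) :=
      Nat.cast_nonneg _
    have hJφ : 0 ≤ 2 + |U| + 2 * |φ| := by positivity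
    have hin : 2 * (2 + |U| + 2 * |φ|) * (2 + |U| + 2 * |φ|) * |t| *
        Real.exp (Real.exp 1 * (2 * (2 + |U| + 2 * |φ|) * ((22 : ℕ) : ℝ)) * |t| - ((L / 4 - 2 : ℕ) : ℝ)) ≤
        2 * (2 + |U| + 2 * (1 / 2 : ℝ)) * (2 + |U| + 2 * (1 / 2 : ℝ)) *
            (((L / 4 - 2 : ℕ) : ℝ) / (88 * Real.exp 1 * (2 + |U| + 2 * (1 / 2 : ℝ)))) *
          Real.exp (-((L / 4 - 2 : ℕ) : ℝ) / 2) := by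
      refine mul_le_mul ?_ (Real.exp_le_exp.2 h3) (Real.exp_pos _).le (by positivity)
      exact mul_le_mul (mul_le_mul (by linarith) hJle hJφ (by positivity)) ht ht0 (by positivity)
    refine mul_le_mul (mul_le_mul_of_nonneg_left (mul_le_mul_of_nonneg_left
      (mul_le_mul_of_nonneg_left hin hN) (mul_nonneg zero_le_two hn)) hN) ht ht0 ?_
    exact mul_nonneg hN (mul_nonneg (mul_nonneg zero_le_two hn) (mul_nonneg hN (by positivity)))
  have hε0 : 0 ≤ (Fintype.card (HubbardIdx (fermionTorusGraph 2 L) ⊕ (ZMod L × Fin 2)) : ℝ) *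
        (2 * ‖seamTwist L φ‖ *
          ((Fintype.card (HubbardIdx (fermionTorusGraph 2 L) ⊕ (ZMod L × Fin 2)) : ℝ) *
            (2 * (2 + |U| + 2 * (1 / 2 : ℝ)) * (2 + |U| + 2 * (1 / 2 : ℝ)) *
                (((L / 4 - 2 : ℕ) : ℝ) / (88 * Real.exp 1 * (2 + |U| + 2 * (1 / 2 : ℝ)))) *
              Real.exp (-((L / 4 - 2 : ℕ) : ℝ) / 2)))) *
        (((L / 4 - 2 : ℕ) : ℝ) / (88 * Real.exp 1 * (2 + |U| + 2 * (1 / 2 : ℝ)))) :=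
    mul_nonneg (mul_nonneg (Nat.cast_nonneg _) (mul_nonneg (mul_nonneg zero_le_two (norm_nonneg _))
      (mul_nonneg (Nat.cast_nonneg _) (by positivity)))) hT0
  have h := norm_sectorGibbs_farBond_flux_sub_le_of_leakage L p hp U hβ φ (ξ := ξ) (C := C) (k := k) hr hrL hT0
    hε0 hε hC y
  clear hε hε0 hC hexp
  refine h.trans ?_
  clear h
  have hn : 0 ≤ ‖seamTwist L φ‖ := norm_nonneg _
  have hN := card_seamAugmentedIdx_le L
  gcongr

end PerBond

/-! ## §5 Stub B: the far-cut persistent current vanishes on a flux window -/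

section Main

/-- `|Re z − Re w| ≤ ‖z − w‖`. [folklore] -/
theorem abs_re_sub_re_le {z w : ℂ} {b : ℝ} (h : ‖z - w‖ ≤ b) : |z.re - w.re| ≤ b := by
  rw [← Complex.sub_re]
  exact (Complex.abs_re_le_norm _).trans h

/-- A finite sum whose terms are within `b` of the terms of a zero-sum family is at most `|ι| · b` in modulus.
[folklore] -/
theorem abs_sum_le_card_mul_of_sub_le {ι : Type*} [Fintype ι] {f g : ι → ℝ} {b : ℝ} (hg : ∑ i, g i = 0)
    (h : ∀ i, |f i - g i| ≤ b) : |∑ i, f i| ≤ Fintype.card ι * b := by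
  have hfg : ∑ i, f i = ∑ i, (f i - g i) := by rw [Finset.sum_sub_distrib, hg, sub_zero]
  rw [hfg]
  refine (Finset.abs_sum_le_sum_abs _ _).trans ((Finset.sum_le_sum fun i _ => h i).trans ?_)
  rw [Finset.sum_const, Finset.card_univ, nsmul_eq_mul]

/-- **STUB B of line `gauge_qbp_far_seam` (hypothesis form over the line's unfolded objects).** For every union-of-sectors
family of coordinate predicates `p L` (in the line: the `(N_L, S^z
    = 0)` sector at hole density `1 - n`) and every `β > 0`:
uniform exponential clustering of the flux-FREE sector Gibbs state against the plain cut currents (`CurrentClustering U n β ξ`,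
unfolded) implies that the far-cut persistent current `Σ_y Re ⟨j_{⌊L/2⌋,y}⟩_{p,φ}` of the flux-`φ` torus is bounded by some
`ε_L → 0` uniformly on a flux window `|φ| ≤ θ₁`, `θ₁ = min(1/2, 1/(96βξ), 1/(192β), π/(8448 e (3+|U|) β²)) > 0`
(`PersistentCurrentVanishes U n β θ₁`, unfolded). Mechanism: time reversal (`⟨j⟩_{p,0}
    = 0`), the per-bond LPPL estimate on the
window (quantum belief propagation `e^{-β(H₀+V_φ)} = E e^{-βH₀} Eᴴ` with `‖V_φ‖
    ≤ 4L|φ|`, Lieb–Robinson localisation of `E` to the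
collar `|x₁|_∘ ≤ ⌊L/4⌋`, one clustering covariance at distance `⌊L/2⌋-1-⌊L/4⌋`), summed over the `L` bonds of the antipodal cut,
and the explicit majorant `K_A L^{2k+1} e^{-L/(8ξ)} + K_B L^{12} e^{-L/16} + K_C L^2 e^{-πL/(704e(3+|U|)β)} → 0`.
[cite: CapelEtAl2023, Theorem 14 and Remark 12; arXiv:2310.09182] -/
theorem farCutCurrent_vanishes_of_currentClustering
    (p : ∀ L : ℕ, Finset (Orb (FermionTorus 2 L)) → Prop) [∀ L, DecidablePred (p L)]
    (hp : ∀ (L : ℕ) [NeZero L] (X : Matrix (Finset (Orb (FermionTorus 2 L))) (Finset (Orb (FermionTorus 2 L))) ℂ),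
      PreservesSectors X → ∀ s t, p L s → ¬ p L t → X s t = 0 ∧ X t s = 0)
    {U β ξ : ℝ} (hβ : 0 < β)
    (hC : 0 < ξ ∧ ∃ C : ℝ, ∃ k L₀ : ℕ, ∀ (L : ℕ) [NeZero L], L₀ ≤ L →
      ∀ (X : Finset (FermionTorus 2 L))
        (A : Matrix (Finset (Orb (FermionTorus 2 L))) (Finset (Orb (FermionTorus 2 L))) ℂ),
        A ∈ carEvenSubalgebra (orbSet X) → (∀ s t, p L s → ¬ p L t → A s t = 0 ∧ A t s = 0) →
        ∀ (X₀ y : ZMod L) (d : ℕ),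
          (∀ x ∈ X, d ≤ torusDist x.toTorusSite ![X₀, y] ∧
            d ≤ torusDist x.toTorusSite ![X₀ - 1, y]) →
          ‖gibbsState β ((hubbardTorusTT'Flux L 0 U 0).toBlock (p L) (p L))
                ((A * ∑ σ : Fin 2,
                    ((-Complex.I) • (creation (orb (FermionTorus.ofTorusSite ![X₀, y]) σ) *
                        annihilation (orb (FermionTorus.ofTorusSite ![X₀ - 1, y]) σ)) +
                      Complex.I • (creation (orb (FermionTorus.ofTorusSite ![X₀ - 1, y]) σ) *
                        annihilation (orb (FermionTorus.ofTorusSite ![X₀, y]) σ)))).toBlock (p L) (p L))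
              - gibbsState β ((hubbardTorusTT'Flux L 0 U 0).toBlock (p L) (p L)) (A.toBlock (p L) (p L)) *
                gibbsState β ((hubbardTorusTT'Flux L 0 U 0).toBlock (p L) (p L))
                  ((∑ σ : Fin 2,
                    ((-Complex.I) • (creation (orb (FermionTorus.ofTorusSite ![X₀, y]) σ) *
                        annihilation (orb (FermionTorus.ofTorusSite ![X₀ - 1, y]) σ)) +
                      Complex.I • (creation (orb (FermionTorus.ofTorusSite ![X₀ - 1, y]) σ) *
                        annihilation (orb (FermionTorus.ofTorusSite ![X₀, y]) σ)))).toBlock (p L) (p L))‖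
            ≤ C * ‖A‖ * (X.card : ℝ) ^ k * Real.exp (-(d : ℝ) / ξ)) :
    ∃ θ₁ : ℝ, 0 < θ₁ ∧ ∃ ε : ℕ → ℝ, Tendsto ε atTop (𝓝 0) ∧ ∃ L₀ : ℕ, ∀ (L : ℕ) [NeZero L], L₀ ≤ L →
      ∀ φ : ℝ, |φ| ≤ θ₁ →
        |∑ y : ZMod L, (gibbsState β ((hubbardTorusTT'Flux L 0 U φ).toBlock (p L) (p L))
            ((∑ σ : Fin 2,
                ((-Complex.I) • (creation (orb (FermionTorus.ofTorusSite ![((L / 2 : ℕ) : ZMod L), y]) σ) *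
                    annihilation (orb (FermionTorus.ofTorusSite ![((L / 2 : ℕ) : ZMod L) - 1, y]) σ)) +
                  Complex.I • (creation (orb (FermionTorus.ofTorusSite ![((L / 2 : ℕ) : ZMod L) - 1, y]) σ) *
                    annihilation (orb (FermionTorus.ofTorusSite ![((L / 2 : ℕ) : ZMod L), y]) σ)))).toBlock
              (p L) (p L))).re| ≤ ε L := by
  obtain ⟨hξ, C, k, L₀, hCL⟩ := hC
  have hJ0 : (0 : ℝ) < 2 + |U| + 2 * (1 / 2 : ℝ) := by positivity
  have hθpos : (0 : ℝ) < (min (1 / 2 : ℝ) (min (1 / (96 * β * ξ)) (min (1 / (192 * β)) (π / (8448 * Real.exp 1 * (2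
      + |U| + 2 * (1 / 2 : ℝ)) * β ^ 2))))) := by positivity
  have hθ0 := hθpos.le
  have hθ2 : (min (1 / 2 : ℝ) (min (1 / (96 * β * ξ)) (min (1 / (192 * β)) (π / (8448 * Real.exp 1 * (2 + |U| + 2
      * (1 / 2 : ℝ)) * β ^ 2))))) ≤ 1 / 2 := min_le_left _ _
  have hθξ : 12 * β * (min (1 / 2 : ℝ) (min (1 / (96 * β * ξ)) (min (1 / (192 * β)) (π / (8448 * Real.exp 1 * (2
      + |U| + 2 * (1 / 2 : ℝ)) * β ^ 2))))) ≤ 1 / (8 * ξ) := by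
    calc 12 * β * (min (1 / 2 : ℝ) (min (1 / (96 * β * ξ)) (min (1 / (192 * β)) (π / (8448 * Real.exp 1 * (2 + |U|
        + 2 * (1 / 2 : ℝ)) * β ^ 2)))))
        ≤ 12 * β * (1 / (96 * β * ξ)) :=
          mul_le_mul_of_nonneg_left ((min_le_right _ _).trans (min_le_left _ _)) (by positivity)
      _ = 1 / (8 * ξ) := by field_simp; ring
  have hθβ : 12 * β * (min (1 / 2 : ℝ) (min (1 / (96 * β * ξ)) (min (1 / (192 * β)) (π / (8448 * Real.exp 1 * (2
      + |U| + 2 * (1 / 2 : ℝ)) * β ^ 2))))) ≤ 1 / 16 := by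
    calc 12 * β * (min (1 / 2 : ℝ) (min (1 / (96 * β * ξ)) (min (1 / (192 * β)) (π / (8448 * Real.exp 1 * (2 + |U|
        + 2 * (1 / 2 : ℝ)) * β ^ 2)))))
        ≤ 12 * β * (1 / (192 * β)) :=
          mul_le_mul_of_nonneg_left ((min_le_right _ _).trans ((min_le_right _ _).trans (min_le_left _ _)))
            (by positivity)
      _ = 1 / 16 := by field_simp; ring
  have hθU : 12 * β * (min (1 / 2 : ℝ) (min (1 / (96 * β * ξ)) (min (1 / (192 * β)) (π / (8448 * Real.exp 1 * (2
      + |U| + 2 * (1 / 2 : ℝ)) * β ^ 2))))) ≤ π / (704 * Real.exp 1 * (2 + |U| + 2 * (1 / 2 : ℝ)) * β) := by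
    calc 12 * β * (min (1 / 2 : ℝ) (min (1 / (96 * β * ξ)) (min (1 / (192 * β)) (π / (8448 * Real.exp 1 * (2 + |U|
        + 2 * (1 / 2 : ℝ)) * β ^ 2)))))
        ≤ 12 * β * (π / (8448 * Real.exp 1 * (2 + |U| + 2 * (1 / 2 : ℝ)) * β ^ 2)) :=
          mul_le_mul_of_nonneg_left ((min_le_right _ _).trans ((min_le_right _ _).trans (min_le_right _ _)))
            (by positivity)
      _ = π / (704 * Real.exp 1 * (2 + |U| + 2 * (1 / 2 : ℝ)) * β) := by
          have he : Real.exp 1 ≠ 0 := (Real.exp_pos 1).ne'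
          field_simp
          ring
  refine ⟨(min (1 / 2 : ℝ) (min (1 / (96 * β * ξ)) (min (1 / (192 * β)) (π / (8448 * Real.exp 1 * (2 + |U| + 2
      * (1 / 2 : ℝ)) * β ^ 2))))), hθpos, fun L => (L : ℝ) * (Real.exp (β * (4 * L * (min (1 / 2 : ℝ) (min (1 / (96
      * β * ξ)) (min (1 / (192 * β)) (π / (8448 * Real.exp 1 * (2 + |U| + 2 * (1 / 2 : ℝ)) * β ^ 2))))))) *
        (max C 0 * Real.exp (β * (4 * L * (min (1 / 2 : ℝ) (min (1 / (96 * β * ξ)) (min (1 / (192 * β)) (π / (8448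
            * Real.exp 1 * (2 + |U| + 2 * (1 / 2 : ℝ)) * β ^ 2))))))) * ((L : ℝ) ^ 2) ^ k *
            Real.exp (-((L / 2 - 1 - L / 4 : ℕ) : ℝ) / ξ) +
          4 * Real.exp (β / 2 * (4 * L * (min (1 / 2 : ℝ) (min (1 / (96 * β * ξ)) (min (1 / (192 * β)) (π / (8448
              * Real.exp 1 * (2 + |U| + 2 * (1 / 2 : ℝ)) * β ^ 2))))))) *
            (β / 2 *
                (((4 * (L : ℝ) ^ 4) *
                    (2 * (4 * L * (min (1 / 2 : ℝ) (min (1 / (96 * β * ξ)) (min (1 / (192 * β)) (π / (8448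
                        * Real.exp 1 * (2 + |U| + 2 * (1 / 2 : ℝ)) * β ^ 2)))))) *
                      ((4 * (L : ℝ) ^ 4) *
                        (2 * (2 + |U| + 2 * (1 / 2 : ℝ)) * (2 + |U| + 2 * (1 / 2 : ℝ)) *
                            (((L / 4 - 2 : ℕ) : ℝ) / (88 * Real.exp 1 * (2 + |U| + 2 * (1 / 2 : ℝ)))) *
                          Real.exp (-((L / 4 - 2 : ℕ) : ℝ) / 2)))) *
                    (((L / 4 - 2 : ℕ) : ℝ) / (88 * Real.exp 1 * (2 + |U| + 2 * (1 / 2 : ℝ))))) +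
                  2 * (4 * L * (min (1 / 2 : ℝ) (min (1 / (96 * β * ξ)) (min (1 / (192 * β)) (π / (8448
                      * Real.exp 1 * (2 + |U| + 2 * (1 / 2 : ℝ)) * β ^ 2)))))) *
                    Real.exp (-(π / β * (((L / 4 - 2 : ℕ) : ℝ) / (88 * Real.exp 1 * (2 + |U| + 2 * (1 / 2 : ℝ))))))) *
              Real.exp (β * (4 * L * (min (1 / 2 : ℝ) (min (1 / (96 * β * ξ)) (min (1 / (192 * β)) (π / (8448
                  * Real.exp 1 * (2 + |U| + 2 * (1 / 2 : ℝ)) * β ^ 2)))))))) *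
            4)), ?_, max L₀ 8, ?_⟩
  · -- the bound tends to zero: squeeze under the explicit majorant
    have hκA : (0 : ℝ) < 1 / (8 * ξ) := by positivity
    have hκB : (0 : ℝ) < 1 / 16 := by norm_num
    have hκC : (0 : ℝ) < π / (704 * Real.exp 1 * (2 + |U| + 2 * (1 / 2 : ℝ)) * β) := by positivity
    have hlim := ((tendsto_const_mul_pow_mul_exp_neg (max C 0 * Real.exp (3 / (2 * ξ))) (2 * k + 1) hκA).add
      (tendsto_const_mul_pow_mul_exp_neg (1024 * β * (2 + |U| + 2 * (1 / 2 : ℝ)) ^ 2 * Real.exp (11 / 8)) 12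
        hκB)).add
      (tendsto_const_mul_pow_mul_exp_neg
        (32 * β * Real.exp (11 * π / (352 * Real.exp 1 * (2 + |U| + 2 * (1 / 2 : ℝ)) * β))) 2 hκC)
    rw [add_zero, add_zero] at hlim
    refine squeeze_zero' (Eventually.of_forall fun L => by positivity) ?_ hlim
    exact Filter.eventually_atTop.2 ⟨8, fun L hL => mul_uniformBound_le L hL hβ hξ hθ0 hθ2 hθξ hθβ hθU⟩
  · -- the bound holds: time reversal + the uniform per-bond estimate, summed over the `L` bonds of the cut
    intro L _ hL φ hφ
    have hL8 : 8 ≤ L := le_of_max_le_right hL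
    have h0 := sum_re_gibbsState_fluxZeroBlock_farBond_eq_zero L U β (((L / 2 : ℕ) : ZMod L)) (p L)
    have hB := fun y : ZMod L => abs_re_sub_re_le
      (norm_sectorGibbs_farBond_flux_sub_le_uniform L hL8 (p L) (hp L) U hβ (hCL L (le_of_max_le_left hL)) hθ0 hθ2
        hφ y)
    have h := abs_sum_le_card_mul_of_sub_le h0 hB
    rw [ZMod.card] at h
    exact h

end Main

end Summit.Ventures.CertifiedManyBodySolver.Theorems.TcThermcert1.GaugeQbpFarSeam

end
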